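import Summits.QuantumFields.YangMills.Theorems.UnitScaleTiltProp7FirstVariationCurrent
import HarnessLib

/-!
# Route `UnitScaleTilt`, crux K1 child «MinimiserStabilityRegPr» (stmt-QuantumFields-19200), line «route-R», stub S (`stub_firstVariationOpt`) — layer (i):
# THE EXACT FIRST-ORDER FUNCTIONAL `Lin_{U₀}` KILLS EVERY INFINITESIMAL GAUGE DIRECTION, PINNED AT THE k-CENTRES OR NOT

Cell `ym3-torus` ∕ fleet seat `ym-ust-19200-p1` (gen 10; HUMAN RULING D-0037, YM ladder rung R3).  WHY.  Stub S of the route-R pen bounds the exact first-order term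
`Lin_U(Y)` of the Wilson action at an R2-critical `U` in the direction of a representative `Y`; its proof (card §2(b)–(c)) writes `Lin_U(X) = −Σ_c Λ_c·r_c(X)` through
the Lagrange multipliers of the (0.4)-constraint and needs the freedom `X ↦ X − D_Uλ` to put `X` in a convenient gauge BEFORE estimating.  For `λ` vanishing at the
k-centres (`λ ∈ Lie (4)`) this freedom is criticality; this file shows it holds for EVERY site field `λ` — the Wilson action is invariant under the FULL gauge group, so
its differential kills all infinitesimal gauge directions `Z^λ_b = λ(x) − U₀(b)λ(x′)U₀(b)^*` (`b = (x, x′)`), with no condition at the centres and no criticality.  In the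
tree's letters: the exact linear part of the relative plaquette TELESCOPES, `L_p(Z^λ) = λ(x) − U₀(∂p)λ(x)U₀(∂p)^*` (`x = p.src`; the two far corners cancel by
`QU₀(b₃) = U₀(b₁)U₀(b₂)` and `U₀(∂p)U₀(b₄) = Q`), and `Tr((P₀ − 1)^*(λ − P₀λP₀^*)P₀) = 0` for unitary `P₀` (cyclicity), so the per-plaquette first-order term vanishes
identically, for matrices `λ(x)` of any kind (not only `𝔰𝔲(2)`).  Consequence: `Lin_{U₀}(Y − Z^λ) = Lin_{U₀}(Y)` for every bond field `Y` (additivity through gen 5's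
`lin_eq_neg_half_sum_re_trace_mul_covDivT`), i.e. the coarse-gauge component of any defect is free in stub S.

WHAT IS PROVED (sorry-free, no definition).  `conj_conj_eq` / `linPart_gaugeDir_eq` (the telescoping, abstract and on the lattice), `trace_polar_gaugeDir_eq_zero`,
**`linPlaq_gaugeDir_eq_zero`** (per plaquette), **`lin_gaugeDir_eq_zero`**, **`lin_sub_gaugeDir_eq`** (summed, any `SU(N)`, any torus of the tree).

HONEST SCOPE.  Exact algebra (gauge invariance of the Wilson action at first order, [Balaban1985BackgroundPropagators] (3.9)–(3.11)); nothing of [Balaban1985Variational]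
is asserted; count-neutral helper toward stmt-QuantumFields-19200 (`--supports`).  Not a claim about the continuum limit or the mass gap.

References: T. Bałaban, CMP 99 (1985) 389–434 [Balaban1985BackgroundPropagators] ((3.4) p.391, (3.9)–(3.11) p.392); CMP 102 (1985) 277–309 [Balaban1985Variational]
((22)–(26) pp.281–282, (141)–(143) p.299).
-/

noncomputable section

open scoped BigOperators Matrix.Norms.L2Operator Matrix

namespace Summit.QuantumFields.YangMills.Theorems.Prop7LinGaugeInvariance

open Literature.MathematicalPhysics.QuantumFieldTheory.Balaban1983to89
open B10Eq27TorusAxialLog (unitsField toUField)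
open B10Eq68TorusRegularity (covDivT)
open Summit.QuantumFields.YangMills.Theorems.Prop7CovariantCoercivity (plaqHol_eq_word)
open Summit.QuantumFields.YangMills.Theorems.Prop7FirstVariationCurrent (lin_eq_neg_half_sum_re_trace_mul_covDivT)

/-! ## §1 Algebra -/

section Algebra

variable {n : Type*} [Fintype n] [DecidableEq n]

/-- Transport through a unitary and back: `(QC^*)(C X C^*)(C Q^*)… = …` — precisely, for unitary `C` and any `A, X`:
`A·C^*·(C·X·C^*)·C·A' = A·X·A'`. [folklore] -/
theorem conj_conj_eq (A A' C X : Matrix n n ℂ) (hC : C ∈ Matrix.unitaryGroup n ℂ) :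
    A * star C * (C * X * star C) * (C * A') = A * X * A' := by
  have h : star C * C = 1 := Matrix.mem_unitaryGroup_iff'.mp hC
  calc A * star C * (C * X * star C) * (C * A') = A * (star C * C) * X * (star C * C) * A' := by noncomm_ring
    _ = A * X * A' := by rw [h]; noncomm_ring

/-- **THE EXACT LINEAR PART OF THE RELATIVE PLAQUETTE TELESCOPES ON A GAUGE DIRECTION** (abstract): for special unitaries `U₁ … U₄` (the background around `∂p`,
`Q = U₁U₂U₃⁻¹`, `P₀ = QU₄⁻¹`) and matrices `l₀, l₁, l₂, l₃` (a site field at the corners `x, x+μ, x+ν, x+μ+ν`), with `Z₁ = l₀ − U₁l₁U₁^*`, `Z₂ = l₁ − U₂l₃U₂^*`,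
`Z₃ = l₂ − U₃l₃U₃^*`, `Z₄ = l₀ − U₄l₂U₄^*`: `Z₁ + U₁Z₂U₁^* − QZ₃Q^* − P₀Z₄P₀^* = l₀ − P₀l₀P₀^*`. [cite: Balaban1985BackgroundPropagators, (3.4) p.391] -/
theorem linPart_gaugeDir_eq (U₁ U₂ U₃ U₄ : Matrix.specialUnitaryGroup n ℂ) (l₀ l₁ l₂ l₃ : Matrix n n ℂ) :
    (l₀ - (U₁ : Matrix n n ℂ) * l₁ * star (U₁ : Matrix n n ℂ))
        + (U₁ : Matrix n n ℂ) * (l₁ - (U₂ : Matrix n n ℂ) * l₃ * star (U₂ : Matrix n n ℂ)) * star (U₁ : Matrix n n ℂ)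
        - ((U₁ * U₂ * U₃⁻¹ : Matrix.specialUnitaryGroup n ℂ) : Matrix n n ℂ) * (l₂ - (U₃ : Matrix n n ℂ) * l₃ * star (U₃ : Matrix n n ℂ))
            * star ((U₁ * U₂ * U₃⁻¹ : Matrix.specialUnitaryGroup n ℂ) : Matrix n n ℂ)
        - ((U₁ * U₂ * U₃⁻¹ * U₄⁻¹ : Matrix.specialUnitaryGroup n ℂ) : Matrix n n ℂ) * (l₀ - (U₄ : Matrix n n ℂ) * l₂ * star (U₄ : Matrix n n ℂ))
            * star ((U₁ * U₂ * U₃⁻¹ * U₄⁻¹ : Matrix.specialUnitaryGroup n ℂ) : Matrix n n ℂ)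
      = l₀ - ((U₁ * U₂ * U₃⁻¹ * U₄⁻¹ : Matrix.specialUnitaryGroup n ℂ) : Matrix n n ℂ) * l₀
            * star ((U₁ * U₂ * U₃⁻¹ * U₄⁻¹ : Matrix.specialUnitaryGroup n ℂ) : Matrix n n ℂ) := by
  set A : Matrix n n ℂ := (U₁ : Matrix n n ℂ) with hA
  set B : Matrix n n ℂ := (U₂ : Matrix n n ℂ) with hB
  set C : Matrix n n ℂ := (U₃ : Matrix n n ℂ) with hC
  set D : Matrix n n ℂ := (U₄ : Matrix n n ℂ) with hD
  have hCu : C ∈ Matrix.unitaryGroup n ℂ := U₃.2.1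
  have hDu : D ∈ Matrix.unitaryGroup n ℂ := U₄.2.1
  have hQ : ((U₁ * U₂ * U₃⁻¹ : Matrix.specialUnitaryGroup n ℂ) : Matrix n n ℂ) = A * B * star C := by
    simp only [Submonoid.coe_mul]; rfl
  have hP : ((U₁ * U₂ * U₃⁻¹ * U₄⁻¹ : Matrix.specialUnitaryGroup n ℂ) : Matrix n n ℂ) = A * B * star C * star D := by
    simp only [Submonoid.coe_mul]; rfl
  rw [hQ, hP]
  simp only [star_mul, star_star, mul_sub, sub_mul]
  -- the two telescoping cancellations
  have k₃ : A * B * star C * (C * l₃ * star C) * (C * (star B * star A)) = A * B * l₃ * (star B * star A) :=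
    conj_conj_eq (A * B) (star B * star A) C l₃ hCu
  have k₄ : A * B * star C * star D * (D * l₂ * star D) * (D * (C * (star B * star A)))
      = A * B * star C * l₂ * (C * (star B * star A)) := by
    have := conj_conj_eq (A * B * star C) (C * (star B * star A)) D l₂ hDu
    simpa only [mul_assoc] using this
  rw [k₃, k₄]
  noncomm_ring

/-- For unitary `P₀` and any `l`: `Tr((P₀ − 1)^*·(l − P₀lP₀^*)·P₀) = 0` (cyclicity of the trace). [folklore] -/
theorem trace_polar_gaugeDir_eq_zero (P₀ l : Matrix n n ℂ) (hP : P₀ ∈ Matrix.unitaryGroup n ℂ) :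
    ((P₀ - 1)ᴴ * ((l - P₀ * l * star P₀) * P₀)).trace = 0 := by
  have h1 : star P₀ * P₀ = 1 := Matrix.mem_unitaryGroup_iff'.mp hP
  have h2 : P₀ * star P₀ = 1 := Matrix.mem_unitaryGroup_iff.mp hP
  rw [← Matrix.star_eq_conjTranspose, star_sub, star_one]
  have e : (star P₀ - 1) * ((l - P₀ * l * star P₀) * P₀)
      = star P₀ * l * P₀ - star P₀ * P₀ * l * (star P₀ * P₀) - l * P₀ + P₀ * l * (star P₀ * P₀) := by noncomm_ring
  rw [e, h1, Matrix.trace_add, Matrix.trace_sub, Matrix.trace_sub, one_mul, mul_one, mul_one,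
    Matrix.trace_mul_cycle (star P₀) l P₀, h2, one_mul, Matrix.trace_mul_comm P₀ l]
  ring

end Algebra

/-! ## §2 On the lattice: per plaquette and summed -/

section Lattice

variable {P : Params} {j : ℕ} {N : ℕ} [NeZero N]

omit [NeZero N] in
/-- Unit shifts in two directions commute on the torus (tree: `BlockAveragingEMLProp2.shift_shift_comm`). [folklore] -/
private theorem shift_shift_comm' (y : Site P j) (μ ν : Fin P.d) : (y.shift μ).shift ν = (y.shift ν).shift μ := by
  funext κ
  by_cases hκν : κ = ν
  · subst hκν
    by_cases hκμ : κ = μ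
    · subst hκμ; rfl
    · simp [Site.shift, Function.update_apply, hκμ]
  · by_cases hκμ : κ = μ
    · subst hκμ
      simp [Site.shift, Function.update_apply, hκν]
    · simp [Site.shift, Function.update_apply, hκν, hκμ]

/-- **PER PLAQUETTE: THE EXACT FIRST-ORDER TERM VANISHES ON EVERY INFINITESIMAL GAUGE DIRECTION** `Z^λ_b = λ(b.src) − U₀(b)λ(b.src + e_{b.dir})U₀(b)^*`
(`λ : sites → M_N(ℂ)` arbitrary — no condition at the k-centres, no tracelessness): `½Re Tr((U₀(∂p) − 1)^*·L_p(Z^λ)·U₀(∂p)) = 0`.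
[cite: Balaban1985BackgroundPropagators, (3.4) p.391, (3.9)-(3.11) p.392] -/
theorem linPlaq_gaugeDir_eq_zero (U₀ : GaugeField P j (Matrix.specialUnitaryGroup (Fin N) ℂ)) (lam : Site P j → Matrix (Fin N) (Fin N) ℂ) (p : Plaq P j) :
    (1 / 2) * ((((((GaugeField.plaqHol U₀ p : Matrix.specialUnitaryGroup (Fin N) ℂ) : Matrix (Fin N) (Fin N) ℂ)) - 1)ᴴ
          * (((lam p.src - (U₀ ⟨p.src, p.μ⟩ : Matrix (Fin N) (Fin N) ℂ) * lam (p.src.shift p.μ) * star (U₀ ⟨p.src, p.μ⟩ : Matrix (Fin N) (Fin N) ℂ))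
              + (U₀ ⟨p.src, p.μ⟩ : Matrix (Fin N) (Fin N) ℂ)
                  * (lam (p.src.shift p.μ) - (U₀ ⟨p.src.shift p.μ, p.ν⟩ : Matrix (Fin N) (Fin N) ℂ) * lam ((p.src.shift p.μ).shift p.ν)
                      * star (U₀ ⟨p.src.shift p.μ, p.ν⟩ : Matrix (Fin N) (Fin N) ℂ))
                  * star (U₀ ⟨p.src, p.μ⟩ : Matrix (Fin N) (Fin N) ℂ)
              - ((U₀ ⟨p.src, p.μ⟩ * U₀ ⟨p.src.shift p.μ, p.ν⟩ * (U₀ ⟨p.src.shift p.ν, p.μ⟩)⁻¹ : Matrix.specialUnitaryGroup (Fin N) ℂ) : Matrix (Fin N) (Fin N) ℂ)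
                  * (lam (p.src.shift p.ν) - (U₀ ⟨p.src.shift p.ν, p.μ⟩ : Matrix (Fin N) (Fin N) ℂ) * lam ((p.src.shift p.ν).shift p.μ)
                      * star (U₀ ⟨p.src.shift p.ν, p.μ⟩ : Matrix (Fin N) (Fin N) ℂ))
                  * star ((U₀ ⟨p.src, p.μ⟩ * U₀ ⟨p.src.shift p.μ, p.ν⟩ * (U₀ ⟨p.src.shift p.ν, p.μ⟩)⁻¹ : Matrix.specialUnitaryGroup (Fin N) ℂ) : Matrix (Fin N) (Fin N) ℂ)
              - ((GaugeField.plaqHol U₀ p : Matrix.specialUnitaryGroup (Fin N) ℂ) : Matrix (Fin N) (Fin N) ℂ)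
                  * (lam p.src - (U₀ ⟨p.src, p.ν⟩ : Matrix (Fin N) (Fin N) ℂ) * lam (p.src.shift p.ν) * star (U₀ ⟨p.src, p.ν⟩ : Matrix (Fin N) (Fin N) ℂ))
                  * star ((GaugeField.plaqHol U₀ p : Matrix.specialUnitaryGroup (Fin N) ℂ) : Matrix (Fin N) (Fin N) ℂ))
            * ((GaugeField.plaqHol U₀ p : Matrix.specialUnitaryGroup (Fin N) ℂ) : Matrix (Fin N) (Fin N) ℂ))).trace).re = 0 := by
  rw [shift_shift_comm' p.src p.ν p.μ, plaqHol_eq_word U₀ p, linPart_gaugeDir_eq,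
    trace_polar_gaugeDir_eq_zero _ _ (U₀ ⟨p.src, p.μ⟩ * U₀ ⟨p.src.shift p.μ, p.ν⟩ * (U₀ ⟨p.src.shift p.ν, p.μ⟩)⁻¹ * (U₀ ⟨p.src, p.ν⟩)⁻¹).2.1,
    Complex.zero_re, mul_zero]

/-- **`Lin_{U₀}(Z^λ) = 0` FOR EVERY SITE FIELD `λ`** (summed over the plaquettes of any torus of the tree; no condition at the k-centres, no criticality of `U₀`).
[cite: Balaban1985BackgroundPropagators, (3.9)-(3.11) p.392] -/
theorem lin_gaugeDir_eq_zero (U₀ : GaugeField P j (Matrix.specialUnitaryGroup (Fin N) ℂ)) (lam : Site P j → Matrix (Fin N) (Fin N) ℂ) :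
    ∑ p : Plaq P j, (1 / 2) * ((((((GaugeField.plaqHol U₀ p : Matrix.specialUnitaryGroup (Fin N) ℂ) : Matrix (Fin N) (Fin N) ℂ)) - 1)ᴴ
          * (((fun b : PBond P j => lam b.src - (U₀ b : Matrix (Fin N) (Fin N) ℂ) * lam (b.src.shift b.dir) * star (U₀ b : Matrix (Fin N) (Fin N) ℂ)) ⟨p.src, p.μ⟩
              + (U₀ ⟨p.src, p.μ⟩ : Matrix (Fin N) (Fin N) ℂ)
                  * (fun b : PBond P j => lam b.src - (U₀ b : Matrix (Fin N) (Fin N) ℂ) * lam (b.src.shift b.dir) * star (U₀ b : Matrix (Fin N) (Fin N) ℂ))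
                      ⟨p.src.shift p.μ, p.ν⟩ * star (U₀ ⟨p.src, p.μ⟩ : Matrix (Fin N) (Fin N) ℂ)
              - ((U₀ ⟨p.src, p.μ⟩ * U₀ ⟨p.src.shift p.μ, p.ν⟩ * (U₀ ⟨p.src.shift p.ν, p.μ⟩)⁻¹ : Matrix.specialUnitaryGroup (Fin N) ℂ) : Matrix (Fin N) (Fin N) ℂ)
                  * (fun b : PBond P j => lam b.src - (U₀ b : Matrix (Fin N) (Fin N) ℂ) * lam (b.src.shift b.dir) * star (U₀ b : Matrix (Fin N) (Fin N) ℂ))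
                      ⟨p.src.shift p.ν, p.μ⟩
                  * star ((U₀ ⟨p.src, p.μ⟩ * U₀ ⟨p.src.shift p.μ, p.ν⟩ * (U₀ ⟨p.src.shift p.ν, p.μ⟩)⁻¹ : Matrix.specialUnitaryGroup (Fin N) ℂ) : Matrix (Fin N) (Fin N) ℂ)
              - ((GaugeField.plaqHol U₀ p : Matrix.specialUnitaryGroup (Fin N) ℂ) : Matrix (Fin N) (Fin N) ℂ)
                  * (fun b : PBond P j => lam b.src - (U₀ b : Matrix (Fin N) (Fin N) ℂ) * lam (b.src.shift b.dir) * star (U₀ b : Matrix (Fin N) (Fin N) ℂ))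
                      ⟨p.src, p.ν⟩
                  * star ((GaugeField.plaqHol U₀ p : Matrix.specialUnitaryGroup (Fin N) ℂ) : Matrix (Fin N) (Fin N) ℂ))
            * ((GaugeField.plaqHol U₀ p : Matrix.specialUnitaryGroup (Fin N) ℂ) : Matrix (Fin N) (Fin N) ℂ))).trace).re = 0 := by
  refine Finset.sum_eq_zero fun p _ => ?_
  exact linPlaq_gaugeDir_eq_zero U₀ lam p

/-- **THE COARSE-GAUGE FREEDOM OF STUB S**: `Lin_{U₀}(Y − Z^λ) = Lin_{U₀}(Y)` for every bond field `Y` and every site field `λ` (additivity of the current pairing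
`Lin_{U₀}(Z) = −½Σ_b Re Tr(Z(b)·(D^{1*}_{U₀}∂U₀)(b))` of gen 5 plus `lin_gaugeDir_eq_zero`). [cite: Balaban1985BackgroundPropagators, (3.9)-(3.11) p.392] -/
theorem lin_sub_gaugeDir_eq (U₀ : GaugeField P j (Matrix.specialUnitaryGroup (Fin N) ℂ)) (Y : PBond P j → Matrix (Fin N) (Fin N) ℂ)
    (lam : Site P j → Matrix (Fin N) (Fin N) ℂ) :
    ∑ p : Plaq P j, (1 / 2) * ((((((GaugeField.plaqHol U₀ p : Matrix.specialUnitaryGroup (Fin N) ℂ) : Matrix (Fin N) (Fin N) ℂ)) - 1)ᴴ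
          * (((fun b : PBond P j => Y b - (lam b.src - (U₀ b : Matrix (Fin N) (Fin N) ℂ) * lam (b.src.shift b.dir) * star (U₀ b : Matrix (Fin N) (Fin N) ℂ))) ⟨p.src, p.μ⟩
              + (U₀ ⟨p.src, p.μ⟩ : Matrix (Fin N) (Fin N) ℂ)
                  * (fun b : PBond P j => Y b - (lam b.src - (U₀ b : Matrix (Fin N) (Fin N) ℂ) * lam (b.src.shift b.dir) * star (U₀ b : Matrix (Fin N) (Fin N) ℂ)))
                      ⟨p.src.shift p.μ, p.ν⟩ * star (U₀ ⟨p.src, p.μ⟩ : Matrix (Fin N) (Fin N) ℂ)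
              - ((U₀ ⟨p.src, p.μ⟩ * U₀ ⟨p.src.shift p.μ, p.ν⟩ * (U₀ ⟨p.src.shift p.ν, p.μ⟩)⁻¹ : Matrix.specialUnitaryGroup (Fin N) ℂ) : Matrix (Fin N) (Fin N) ℂ)
                  * (fun b : PBond P j => Y b - (lam b.src - (U₀ b : Matrix (Fin N) (Fin N) ℂ) * lam (b.src.shift b.dir) * star (U₀ b : Matrix (Fin N) (Fin N) ℂ)))
                      ⟨p.src.shift p.ν, p.μ⟩
                  * star ((U₀ ⟨p.src, p.μ⟩ * U₀ ⟨p.src.shift p.μ, p.ν⟩ * (U₀ ⟨p.src.shift p.ν, p.μ⟩)⁻¹ : Matrix.specialUnitaryGroup (Fin N) ℂ) : Matrix (Fin N) (Fin N) ℂ)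
              - ((GaugeField.plaqHol U₀ p : Matrix.specialUnitaryGroup (Fin N) ℂ) : Matrix (Fin N) (Fin N) ℂ)
                  * (fun b : PBond P j => Y b - (lam b.src - (U₀ b : Matrix (Fin N) (Fin N) ℂ) * lam (b.src.shift b.dir) * star (U₀ b : Matrix (Fin N) (Fin N) ℂ)))
                      ⟨p.src, p.ν⟩
                  * star ((GaugeField.plaqHol U₀ p : Matrix.specialUnitaryGroup (Fin N) ℂ) : Matrix (Fin N) (Fin N) ℂ))
            * ((GaugeField.plaqHol U₀ p : Matrix.specialUnitaryGroup (Fin N) ℂ) : Matrix (Fin N) (Fin N) ℂ))).trace).re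
      = ∑ p : Plaq P j, (1 / 2) * ((((((GaugeField.plaqHol U₀ p : Matrix.specialUnitaryGroup (Fin N) ℂ) : Matrix (Fin N) (Fin N) ℂ)) - 1)ᴴ
          * ((Y ⟨p.src, p.μ⟩
              + (U₀ ⟨p.src, p.μ⟩ : Matrix (Fin N) (Fin N) ℂ) * Y ⟨p.src.shift p.μ, p.ν⟩ * star (U₀ ⟨p.src, p.μ⟩ : Matrix (Fin N) (Fin N) ℂ)
              - ((U₀ ⟨p.src, p.μ⟩ * U₀ ⟨p.src.shift p.μ, p.ν⟩ * (U₀ ⟨p.src.shift p.ν, p.μ⟩)⁻¹ : Matrix.specialUnitaryGroup (Fin N) ℂ) : Matrix (Fin N) (Fin N) ℂ)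
                  * Y ⟨p.src.shift p.ν, p.μ⟩
                  * star ((U₀ ⟨p.src, p.μ⟩ * U₀ ⟨p.src.shift p.μ, p.ν⟩ * (U₀ ⟨p.src.shift p.ν, p.μ⟩)⁻¹ : Matrix.specialUnitaryGroup (Fin N) ℂ) : Matrix (Fin N) (Fin N) ℂ)
              - ((GaugeField.plaqHol U₀ p : Matrix.specialUnitaryGroup (Fin N) ℂ) : Matrix (Fin N) (Fin N) ℂ) * Y ⟨p.src, p.ν⟩
                  * star ((GaugeField.plaqHol U₀ p : Matrix.specialUnitaryGroup (Fin N) ℂ) : Matrix (Fin N) (Fin N) ℂ))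
            * ((GaugeField.plaqHol U₀ p : Matrix.specialUnitaryGroup (Fin N) ℂ) : Matrix (Fin N) (Fin N) ℂ))).trace).re := by
  have h1 := lin_eq_neg_half_sum_re_trace_mul_covDivT U₀
    (fun b : PBond P j => Y b - (lam b.src - (U₀ b : Matrix (Fin N) (Fin N) ℂ) * lam (b.src.shift b.dir) * star (U₀ b : Matrix (Fin N) (Fin N) ℂ)))
  have h2 := lin_eq_neg_half_sum_re_trace_mul_covDivT U₀ Y
  have h3 := lin_eq_neg_half_sum_re_trace_mul_covDivT U₀
    (fun b : PBond P j => lam b.src - (U₀ b : Matrix (Fin N) (Fin N) ℂ) * lam (b.src.shift b.dir) * star (U₀ b : Matrix (Fin N) (Fin N) ℂ))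
  have hg := lin_gaugeDir_eq_zero U₀ lam
  beta_reduce at h1 h3 hg
  beta_reduce
  rw [h1, h2]
  rw [h3] at hg
  have hz : ∑ b : PBond P j, (((lam b.src - (U₀ b : Matrix (Fin N) (Fin N) ℂ) * lam (b.src.shift b.dir) * star (U₀ b : Matrix (Fin N) (Fin N) ℂ))
      * covDivT 1 (unitsField (toUField U₀)) b.dir b.src).trace).re = 0 := by
    have : -(1 / 2 : ℝ) ≠ 0 := by norm_num
    exact (mul_eq_zero.mp hg).resolve_left this
  have hsplit : ∑ b : PBond P j, (((Y b - (lam b.src - (U₀ b : Matrix (Fin N) (Fin N) ℂ) * lam (b.src.shift b.dir) * star (U₀ b : Matrix (Fin N) (Fin N) ℂ)))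
        * covDivT 1 (unitsField (toUField U₀)) b.dir b.src).trace).re
      = ∑ b : PBond P j, ((Y b * covDivT 1 (unitsField (toUField U₀)) b.dir b.src).trace).re
        - ∑ b : PBond P j, (((lam b.src - (U₀ b : Matrix (Fin N) (Fin N) ℂ) * lam (b.src.shift b.dir) * star (U₀ b : Matrix (Fin N) (Fin N) ℂ))
            * covDivT 1 (unitsField (toUField U₀)) b.dir b.src).trace).re := by
    rw [← Finset.sum_sub_distrib]
    refine Finset.sum_congr rfl fun b _ => ?_
    rw [Matrix.sub_mul, Matrix.trace_sub, Complex.sub_re]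
  rw [hsplit, hz, sub_zero]

end Lattice

end Summit.QuantumFields.YangMills.Theorems.Prop7LinGaugeInvariance

end
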